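import Literature.Geometry.Lorentzian.CompleteIsometricImmersionOnto
import Literature.Geometry.Lorentzian.CorrespondingBoundaryExtensionPrep
import Literature.Geometry.Lorentzian.CauchyDevelopmentIsometryClasses
import HarnessLib

/-!
# The image of a future timelike geodesically complete spacetime under an isometric embedding is a
# future set; future-complete developments contain the chronological future of the data

Companion to `CompleteIsometricImmersionOnto.lean` / `CompleteDevelopmentMaximal.lean`, where full
geodesic completeness of the source makes an isometric immersion ONTO (O'Neill 1983, Ch. 7,
Cor. 7.29) and hence a geodesically complete Cauchy development maximal. Physically relevant
developments are often only complete TO THE FUTURE (cosmological developments with a past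
singularity, developments constructed by future-stability theorems). For them the one-sided
statement survives:

* `LorentzianMetric.chronologicalFuture_range_subset_of_isIsometricImmersion` — **if
  `f : (N, gN, τN) → (M, gM, τM)` is a time-orientation preserving isometric immersion between
  equidimensional time-oriented Lorentzian manifolds and `exp` of `N` is defined on the whole future
  timecone (every future-directed timelike maximal geodesic of `N` is defined on `[0, 1]`, in
  particular if `N` is future timelike geodesically complete), then `f(N)` is a FUTURE SET:
  `I⁺(f(N)) ⊆ f(N)`.** Proof (the argument of Beem–Ehrlich 1981, Prop. 5.16 (3), "timelike
  geodesically complete ⇒ inextendible", run to the future only, in a uniformly normal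
  neighbourhood): a future timelike curve `c : [a, b] → M` from `f y₀` to `z ∉ f(N)` has a first exit
  parameter `s₀ = inf {s | c s ∉ f(N)}` (`f(N)` is open, `IsIsometricImmersion.isOpenMap`); near the
  exit point `z' = c s₀` take a uniformly normal neighbourhood (`exists_twoPoint_expInverse`) and a
  parameter `s₁ < s₀` with `c([s₁, s₀])` inside it; the radial vector `v = exp_q⁻¹ z'`,
  `q = c s₁ = f y ∈ f(N)`, is future timelike (O'Neill 1983, Ch. 5, Lemma 5.33,
  `isTimelike_expInverse_of_curve`), so `v = df_y w` with `w` future timelike in `N`, `exp_y w` is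
  defined by hypothesis, and `z' = exp_{f y}(df_y w) = f (exp_y w) ∈ f(N)`
  (`IsIsometricImmersion.expMap_comp`) — a contradiction;
* `…_of_isTimelikeGeodesicallyComplete`, `…_of_isGeodesicallyComplete` — the hypothesis from
  timelike / full geodesic completeness;
* `LorentzianMetric.chronologicalPast_range_subset_of_isIsometricImmersion` — time dual (past
  timecone, past set);
* `DataEmbedding.chronologicalFuture_range_subset`, `DataEmbedding.chronologicalFuture_range_embed_subset`
  — for data embeddings / Cauchy developments of the same data: **the image of a future timelike
  complete development `𝒮₁` in any `𝒮₂` it embeds into is a future set containing `I⁺(ι₂ X)`** —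
  the whole chronological future of the data in `𝒮₂` (in particular in the maximal development)
  is isometric to an open subset of `𝒮₁`.

Everything is proved; no definitions and no named facts are introduced.

## References

* J. K. Beem, P. E. Ehrlich, *Global Lorentzian Geometry*, Marcel Dekker 1981, Prop. 5.16 (3) and
  its proof. Key `BeemEhrlich1981`.
* B. O'Neill, *Semi-Riemannian geometry with applications to relativity*, Academic Press 1983,
  Ch. 5, Lemma 5.33 (p. 146); Ch. 3, pp. 90–91; Ch. 14, p. 403 (future sets).
  Key `ONeillSemiRiemannian1983`.
-/

noncomputable section

open Bundle Set Filter Function TopologicalSpace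
open scoped Manifold ContDiff Topology

namespace Literature.Geometry.Lorentzian

open Literature.Geometry.Riemannian

section Core

variable {d : ℕ} {M : Type*} [TopologicalSpace M] [ChartedSpace (EuclideanSpace ℝ (Fin d)) M]
  [IsManifold (𝓡 d) ∞ M] [T2Space M]
  {N : Type*} [TopologicalSpace N] [ChartedSpace (EuclideanSpace ℝ (Fin d)) N]
  [IsManifold (𝓡 d) ∞ N] [T2Space N]

namespace LorentzianMetric

variable {gM : LorentzianMetric (𝓡 d) ∞ M} [gM.HasLeviCivita]
  [CovariantDerivative.ContMDiffCovariantDerivative gM.leviCivita 1]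
  [CovariantDerivative.ContMDiffCovariantDerivative gM.leviCivita (⊤ : ℕ∞)]
  {τM : TimeOrientation gM}
  {gN : LorentzianMetric (𝓡 d) ∞ N} [gN.HasLeviCivita]
  [CovariantDerivative.ContMDiffCovariantDerivative gN.leviCivita 1] {τN : TimeOrientation gN}
  {f : N → M}

/-- **The image of a time-orientation preserving isometric immersion whose source has `exp`
defined on the whole future timecone is a future set: `I⁺(f(N)) ⊆ f(N)`** (Beem–Ehrlich 1981,
proof of Prop. 5.16 (3), to the future; O'Neill 1983, Ch. 5, Lemma 5.33). See the module docstring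
for the proof. [cite: BeemEhrlich1981, Prop. 5.16 (3) (proof)]
[cite: ONeillSemiRiemannian1983, Ch. 5, Lemma 5.33 (p. 146)] -/
theorem chronologicalFuture_range_subset_of_isIsometricImmersion
    (hf : gN.toPseudoRiemannianMetric.IsIsometricImmersion gM.toPseudoRiemannianMetric f)
    (hτ : τN.PreservesTimeOrientation f τM)
    (hc : ∀ (y : N) (w : TangentSpace (𝓡 d) y), gN.IsTimelike w → τN.IsFutureDirected w →
      w ∈ expDomain gN.leviCivita y) :
    gM.chronologicalFuture τM (range f) ⊆ range f := by
  rintro z ⟨p, ⟨y₀, rfl⟩, c, a, b, hab, hcurve, hca, hcb⟩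
  set W : Set M := range f with hW_def
  have hWo : IsOpen W := (hf.isOpenMap rfl).isOpen_range
  by_contra hz
  -- continuity of `c` on `[a, b]`
  have hcont : ∀ t ∈ Icc a b, ContinuousAt c t := fun t ht ↦ (hcurve t ht).1.continuousAt
  have hcontOn : ContinuousOn c (Icc a b) := fun t ht ↦ (hcont t ht).continuousWithinAt
  -- the first exit parameter `s₀`
  set T : Set ℝ := Icc a b ∩ c ⁻¹' Wᶜ with hT_def
  have hTc : IsClosed T := hcontOn.preimage_isClosed_of_isClosed isClosed_Icc hWo.isClosed_compl
  have hbT : b ∈ T := ⟨right_mem_Icc.2 hab.le, by rw [mem_preimage, hcb]; exact hz⟩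
  have hTne : T.Nonempty := ⟨b, hbT⟩
  have hTbdd : BddBelow T := ⟨a, fun s hs ↦ hs.1.1⟩
  set s₀ : ℝ := sInf T with hs₀_def
  have hs₀T : s₀ ∈ T := hTc.csInf_mem hTne hTbdd
  have hs₀b : s₀ ≤ b := csInf_le hTbdd hbT
  have has₀ : a ≤ s₀ := hs₀T.1.1
  have hz'W : c s₀ ∉ W := hs₀T.2
  have hbefore : ∀ s, a ≤ s → s < s₀ → c s ∈ W := by
    intro s has hss₀
    by_contra hsW
    have hsT : s ∈ T := ⟨⟨has, hss₀.le.trans hs₀b⟩, hsW⟩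
    exact absurd (csInf_le hTbdd hsT) (not_le.2 hss₀)
  have has₀' : a < s₀ := by
    rcases eq_or_lt_of_le has₀ with h | h
    · exfalso; apply hz'W; rw [← h, hca]; exact ⟨y₀, rfl⟩
    · exact h
  -- the uniformly normal neighbourhood of the exit point `z' = c s₀`
  set z' : M := c s₀ with hz'_def
  obtain ⟨W₁, Src, Ξ, hW₁o, hz'W₁, -, -, hS0, hSdom, hinjF, hΞ, hΞs, -⟩ :=
    exists_twoPoint_expInverse (cov := gM.leviCivita) z'
  -- a parameter `s₁ ∈ [a, s₀)` with `c([s₁, s₀]) ⊆ W₁`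
  obtain ⟨δ, hδ, hball⟩ := Metric.mem_nhds_iff.1
    ((hcont s₀ hs₀T.1).preimage_mem_nhds (hW₁o.mem_nhds hz'W₁))
  set s₁ : ℝ := max a (s₀ - δ / 2) with hs₁_def
  have has₁ : a ≤ s₁ := le_max_left _ _
  have hs₁s₀ : s₁ < s₀ := max_lt has₀' (by linarith)
  have hsub : Icc s₁ s₀ ⊆ Icc a b := Icc_subset_Icc has₁ hs₀b
  have hcW₁ : ∀ t ∈ Icc s₁ s₀, c t ∈ W₁ := by
    intro t ht
    refine hball ?_
    rw [Metric.mem_ball, Real.dist_eq, abs_lt]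
    have h1 : s₀ - δ / 2 ≤ t := (le_max_right _ _).trans ht.1
    constructor <;> linarith [ht.2]
  -- the base point `q = c s₁ = f y ∈ W ∩ W₁`
  obtain ⟨y, hy⟩ : c s₁ ∈ W := hbefore s₁ has₁ hs₁s₀
  have hqW₁ : f y ∈ W₁ := by rw [hy]; exact hcW₁ s₁ (left_mem_Icc.2 hs₁s₀.le)
  -- the local inverse `K = e⁻¹ ∘ Ξ(f y, ·)` of `exp_{f y}` on `W₁`
  -- (adapted from `CorrespondingBoundaryExtension`, step (4))
  set cov := gM.leviCivita with hcov
  set e := trivializationAt (EuclideanSpace ℝ (Fin d)) (TangentSpace (𝓡 d) : M → Type _) z' with he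
  set L : (EuclideanSpace ℝ (Fin d)) →L[ℝ] (EuclideanSpace ℝ (Fin d)) := e.symmL ℝ (f y) with hL
  set K : M → (EuclideanSpace ℝ (Fin d)) := fun x ↦ L (Ξ (f y) x) with hK
  have hΞqs : ContMDiffOn (𝓡 d) 𝓘(ℝ, (EuclideanSpace ℝ (Fin d))) ∞ (fun x ↦ Ξ (f y) x) W₁ := by
    have h1 : ContMDiff (𝓡 d) ((𝓡 d).prod (𝓡 d)) ∞ (fun x : M ↦ (f y, x)) :=
      contMDiff_const.prodMk contMDiff_id
    exact hΞs.comp h1.contMDiffOn fun x hx ↦ ⟨hqW₁, hx⟩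
  have hKsm : ContMDiffOn (𝓡 d) 𝓘(ℝ, (EuclideanSpace ℝ (Fin d))) ∞ K W₁ := by
    have hLs : ContMDiff 𝓘(ℝ, (EuclideanSpace ℝ (Fin d))) 𝓘(ℝ, (EuclideanSpace ℝ (Fin d))) ∞
        (fun ξ : (EuclideanSpace ℝ (Fin d)) ↦ L ξ) := L.contMDiff
    exact hLs.comp_contMDiffOn hΞqs
  have hKexp : ∀ x ∈ W₁,
      expMap cov (f y) ((K x : EuclideanSpace ℝ (Fin d)) : TangentSpace (𝓡 d) (f y)) = x :=
    fun x hx ↦ (hΞ (f y) hqW₁ x hx).2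
  have hKdom : ∀ x ∈ W₁,
      ((K x : EuclideanSpace ℝ (Fin d)) : TangentSpace (𝓡 d) (f y)) ∈ expDomain cov (f y) :=
    fun x hx ↦ (hSdom _ (hΞ (f y) hqW₁ x hx).1).2
  have hΞqq : Ξ (f y) (f y) = 0 := by
    have h1' : (f y, Ξ (f y) (f y)) ∈ Src := (hΞ (f y) hqW₁ (f y) hqW₁).1
    have h2' : (f y, (0 : (EuclideanSpace ℝ (Fin d)))) ∈ Src := hS0 (f y) hqW₁
    have heq : (fun w : M × (EuclideanSpace ℝ (Fin d)) ↦
          (w.1, expMap cov w.1 (e.symmL ℝ w.1 w.2))) (f y, Ξ (f y) (f y)) =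
        (fun w : M × (EuclideanSpace ℝ (Fin d)) ↦
          (w.1, expMap cov w.1 (e.symmL ℝ w.1 w.2))) (f y, (0 : (EuclideanSpace ℝ (Fin d)))) := by
      show (f y, expMap cov (f y) (e.symmL ℝ (f y) (Ξ (f y) (f y)))) =
        (f y, expMap cov (f y) (e.symmL ℝ (f y) 0))
      rw [(hΞ (f y) hqW₁ (f y) hqW₁).2, map_zero, expMap_zero (cov := cov) (f y)]
    exact (Prod.ext_iff.1 (hinjF h1' h2' heq)).2
  have hK0 : K (f y) = 0 := by simp only [hK, hΞqq, map_zero]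
  -- O'Neill's Lemma 5.33 along `c|[s₁, s₀]`: the radial vector `v = exp_{f y}⁻¹ z'` is future
  -- timelike
  have hvC : gM.IsTimelike (x := f y) (K z') ∧ τM.IsFutureDirected (x := f y) (K z') :=
    isTimelike_expInverse_of_curve τM hW₁o hqW₁ hKsm hK0 hKexp hKdom hs₁s₀ (hcurve.mono hsub)
      hy.symm hcW₁
  set v : TangentSpace (𝓡 d) (f y) := ((K z' : EuclideanSpace ℝ (Fin d)) : TangentSpace (𝓡 d) (f y))
    with hv_def
  have hvexp : expMap cov (f y) v = z' := hKexp z' hz'W₁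
  -- pull `v` back to `N`: `v = df_y w`, `w` future timelike
  obtain ⟨w, hw⟩ : ∃ w : TangentSpace (𝓡 d) y, mfderiv (𝓡 d) (𝓡 d) f y w = v :=
    (mfderiv_bijective_of_injective (hf.injective_mfderiv y) rfl).2 v
  have key : ∀ u u' : TangentSpace (𝓡 d) y,
      gM.val (f y) (mfderiv (𝓡 d) (𝓡 d) f y u) (mfderiv (𝓡 d) (𝓡 d) f y u') = gN.val y u u' :=
    fun u u' ↦ by
      have h := congrArg (fun B ↦ B u u') (hf.2 y)
      simpa only [pullbackBilin_apply] using h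
  have hwt : gN.IsTimelike w := by
    show gN.val y w w < 0
    rw [← key, hw]
    exact hvC.1
  have hwf : τN.IsFutureDirected w :=
    TimeOrientation.PreservesTimeOrientation.isFutureDirected_of_mfderiv hτ hf.2
      (by rw [hw]; exact hvC.2)
  -- completeness to the future: `exp_y w` is defined, and `exp` commutes with `f`
  have hwdom : w ∈ expDomain gN.leviCivita y := hc y w hwt hwf
  obtain ⟨-, hexp⟩ := hf.expMap_comp rfl hwdom
  apply hz'W
  refine ⟨expMap gN.toPseudoRiemannianMetric.leviCivita y w, ?_⟩
  rw [← hexp, hw]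
  exact hvexp

/-- The hypothesis of `chronologicalFuture_range_subset_of_isIsometricImmersion` from **timelike
geodesic completeness** of the source (every timelike maximal geodesic is defined on `ℝ ∋ 1`).
Hawking–Ellis 1973, §8.1. [cite: HawkingEllis1973, §8.1, pp. 257–258] -/
theorem mem_expDomain_of_isTimelikeGeodesicallyComplete [Fact (1 ≤ (∞ : ℕ∞ω))]
    (hcpl : gN.IsTimelikeGeodesicallyComplete) (y : N) (w : TangentSpace (𝓡 d) y)
    (hw : gN.IsTimelike w) : w ∈ expDomain gN.leviCivita y := by
  obtain ⟨γ, hγ, hγ0, hγw⟩ := hcpl y w hw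
  refine ⟨hasMaximalGeodesic (cov := gN.leviCivita) y w, ?_⟩
  exact (subset_maximalGeodesicDomain_of_isGeodesicOn (cov := gN.leviCivita) isOpen_univ
    ordConnected_univ (mem_univ 0) (hγ.isGeodesicOn univ) hγ0 hγw).1 (mem_univ 1)

/-- **The image of a timelike geodesically complete spacetime under a time-orientation preserving
isometric immersion (equal dimensions) is a future set.** Beem–Ehrlich 1981, Prop. 5.16 (3)
(proof). [cite: BeemEhrlich1981, Prop. 5.16 (3) (proof)] -/
theorem chronologicalFuture_range_subset_of_isTimelikeGeodesicallyComplete [Fact (1 ≤ (∞ : ℕ∞ω))]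
    (hf : gN.toPseudoRiemannianMetric.IsIsometricImmersion gM.toPseudoRiemannianMetric f)
    (hτ : τN.PreservesTimeOrientation f τM) (hcpl : gN.IsTimelikeGeodesicallyComplete) :
    gM.chronologicalFuture τM (range f) ⊆ range f :=
  chronologicalFuture_range_subset_of_isIsometricImmersion hf hτ fun y w hw _ ↦
    mem_expDomain_of_isTimelikeGeodesicallyComplete hcpl y w hw

/-- **The image of a geodesically complete spacetime under a time-orientation preserving isometric
immersion (equal dimensions) is a future set** (of course it is everything when the target is
connected, `IsIsometricImmersion.surjective_of_isGeodesicallyComplete`; recorded for symmetry).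
[cite: BeemEhrlich1981, Prop. 5.16 (proof)] -/
theorem chronologicalFuture_range_subset_of_isGeodesicallyComplete
    (hf : gN.toPseudoRiemannianMetric.IsIsometricImmersion gM.toPseudoRiemannianMetric f)
    (hτ : τN.PreservesTimeOrientation f τM) (hcpl : IsGeodesicallyComplete gN.leviCivita) :
    gM.chronologicalFuture τM (range f) ⊆ range f :=
  chronologicalFuture_range_subset_of_isIsometricImmersion hf hτ fun y w _ _ ↦
    mem_expDomain_of_isGeodesicallyComplete hcpl y w

/-- **Time dual: if `exp` of the source is defined on the whole PAST timecone, the image is a past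
set, `I⁻(f(N)) ⊆ f(N)`** (apply the future statement to the reversed time orientations).
[cite: BeemEhrlich1981, Prop. 5.16 (3) (proof)] -/
theorem chronologicalPast_range_subset_of_isIsometricImmersion
    (hf : gN.toPseudoRiemannianMetric.IsIsometricImmersion gM.toPseudoRiemannianMetric f)
    (hτ : τN.PreservesTimeOrientation f τM)
    (hc : ∀ (y : N) (w : TangentSpace (𝓡 d) y), gN.IsTimelike w → τN.reverse.IsFutureDirected w →
      w ∈ expDomain gN.leviCivita y) :
    gM.chronologicalPast τM (range f) ⊆ range f :=
  chronologicalFuture_range_subset_of_isIsometricImmersion (τM := τM.reverse) (τN := τN.reverse)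
    hf hτ.reverse hc

end LorentzianMetric

end Core

/-! ### Developments: a future-complete development contains the future of the data -/

section Developments

universe u

variable {n : ℕ} {X : Type u} [TopologicalSpace X] [ChartedSpace (EuclideanSpace ℝ (Fin n)) X]
  [IsManifold (𝓡 n) ∞ X] [ConnectedSpace X] {D : InitialDataSet (𝓡 n) X}

namespace DataEmbedding

/-- **The image of a future timelike complete data embedding in another one is a future set.** If
`ψ : 𝒮₁ → 𝒮₂` is a time-orientation preserving isometric immersion of data embeddings and every
future-directed timelike vector of `𝒮₁` lies in the domain of `exp` (e.g. `𝒮₁` is future timelike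
geodesically complete), then `I⁺(ψ(M₁)) ⊆ ψ(M₁)`. [cite: BeemEhrlich1981, Prop. 5.16 (3) (proof)] -/
theorem chronologicalFuture_range_subset {𝒮₁ 𝒮₂ : DataEmbedding D} {ψ : 𝒮₁.carrier → 𝒮₂.carrier}
    (hψ : 𝒮₁.metric.IsIsometricImmersion 𝒮₂.metric.toPseudoRiemannianMetric ψ)
    (hτ : 𝒮₁.timeOrientation.PreservesTimeOrientation ψ 𝒮₂.timeOrientation)
    (hc : ∀ [𝒮₁.metric.toPseudoRiemannianMetric.HasLeviCivita],
      ∀ (y : 𝒮₁.carrier) (w : TangentSpace (𝓡 (n + 1)) y), 𝒮₁.metric.IsTimelike w →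
        𝒮₁.timeOrientation.IsFutureDirected w → w ∈ expDomain 𝒮₁.metric.leviCivita y) :
    ∀ [𝒮₂.metric.toPseudoRiemannianMetric.HasLeviCivita],
      𝒮₂.metric.chronologicalFuture 𝒮₂.timeOrientation (range ψ) ⊆ range ψ := by
  intro _
  haveI := 𝒮₁.metric.toPseudoRiemannianMetric.hasLeviCivita
  haveI : CovariantDerivative.ContMDiffCovariantDerivative
      𝒮₁.metric.toPseudoRiemannianMetric.leviCivita 1 :=
    ⟨𝒮₁.metric.isLocallyContMDiff_leviCivita_holds 1 (by exact_mod_cast le_top) univ isOpen_univ⟩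
  haveI : CovariantDerivative.ContMDiffCovariantDerivative
      𝒮₂.metric.toPseudoRiemannianMetric.leviCivita 1 :=
    ⟨𝒮₂.metric.isLocallyContMDiff_leviCivita_holds 1 (by exact_mod_cast le_top) univ isOpen_univ⟩
  haveI := Literature.Geometry.Riemannian.contMDiffCovariantDerivative_leviCivita_infty
    𝒮₂.metric.toPseudoRiemannianMetric le_rfl
  exact LorentzianMetric.chronologicalFuture_range_subset_of_isIsometricImmersion hψ hτ hc

/-- **A future timelike complete data embedding contains the chronological future of the data of
any data embedding it maps into**: with `ψ ∘ ι₁ = ι₂`, `I⁺(ι₂ X) ⊆ ψ(M₁)` — the whole chronological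
future of the data in `𝒮₂` (e.g. in the maximal development) is the isometric image of an open
subset of `𝒮₁`. [cite: BeemEhrlich1981, Prop. 5.16 (3) (proof)] -/
theorem chronologicalFuture_range_embed_subset {𝒮₁ 𝒮₂ : DataEmbedding D}
    {ψ : 𝒮₁.carrier → 𝒮₂.carrier}
    (hψ : 𝒮₁.metric.IsIsometricImmersion 𝒮₂.metric.toPseudoRiemannianMetric ψ)
    (hτ : 𝒮₁.timeOrientation.PreservesTimeOrientation ψ 𝒮₂.timeOrientation)
    (hι : ψ ∘ 𝒮₁.embed = 𝒮₂.embed)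
    (hc : ∀ [𝒮₁.metric.toPseudoRiemannianMetric.HasLeviCivita],
      ∀ (y : 𝒮₁.carrier) (w : TangentSpace (𝓡 (n + 1)) y), 𝒮₁.metric.IsTimelike w →
        𝒮₁.timeOrientation.IsFutureDirected w → w ∈ expDomain 𝒮₁.metric.leviCivita y) :
    ∀ [𝒮₂.metric.toPseudoRiemannianMetric.HasLeviCivita],
      𝒮₂.metric.chronologicalFuture 𝒮₂.timeOrientation (range 𝒮₂.embed) ⊆ range ψ := by
  intro _
  have hsub : range 𝒮₂.embed ⊆ range ψ := by
    rw [← hι, range_comp]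
    exact image_subset_range _ _
  exact (LorentzianMetric.chronologicalFuture_mono (M := 𝒮₂.carrier) hsub).trans
    (chronologicalFuture_range_subset hψ hτ hc)

/-- **From an embedding of developments**: if `𝒮₁ ↪ 𝒮₂` (`EmbedsInto`) and `𝒮₁` is future
timelike complete in the above sense, then `I⁺(ι₂ X)` lies in the image of the (unique) embedding.
[cite: BeemEhrlich1981, Prop. 5.16 (3) (proof)] -/
theorem EmbedsInto.exists_chronologicalFuture_range_embed_subset {𝒮₁ 𝒮₂ : DataEmbedding D}
    (h : 𝒮₁.EmbedsInto 𝒮₂)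
    (hc : ∀ [𝒮₁.metric.toPseudoRiemannianMetric.HasLeviCivita],
      ∀ (y : 𝒮₁.carrier) (w : TangentSpace (𝓡 (n + 1)) y), 𝒮₁.metric.IsTimelike w →
        𝒮₁.timeOrientation.IsFutureDirected w → w ∈ expDomain 𝒮₁.metric.leviCivita y) :
    ∃ ψ : 𝒮₁.carrier → 𝒮₂.carrier,
      𝒮₁.metric.IsIsometricImmersion 𝒮₂.metric.toPseudoRiemannianMetric ψ ∧ ψ ∘ 𝒮₁.embed = 𝒮₂.embed ∧
      ∀ [𝒮₂.metric.toPseudoRiemannianMetric.HasLeviCivita],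
        𝒮₂.metric.chronologicalFuture 𝒮₂.timeOrientation (range 𝒮₂.embed) ⊆ range ψ := by
  obtain ⟨ψ, -, -, hψi, hψτ, hψι⟩ := h
  refine ⟨ψ, hψi, hψι, ?_⟩
  intro _
  exact chronologicalFuture_range_embed_subset hψi hψτ hψι hc

end DataEmbedding

end Developments

end Literature.Geometry.Lorentzian

end
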